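import Summits.ABC.IUTFork.Repair.RHCellWeights
import Summits.ABC.IUTFork.Repair.RHSigmaStrataEqPilotGap
import Summits.ABC.IUTFork.Repair.CandExplicit30Real
import Summits.ABC.IUTFork.Cor312ProvK
import Summits.ABC.IUTFork.LDHGenuinePoint
import Literature.IUT.LogVolume.DHProbabilisticSzpiroCorrected
import HarnessLib

/-!
# R-H ROUND 2, Q1′ (i) «MINIMUM Σ»: the per-cell weights AT THE GENUINE BED `settingPrVolSharp X` — the per-PLACE split,
# the total `M = deĝ_lgp(P_Θ) − deĝ(P_q)` (= `T.gap`), and the KNAPSACK inequality `offRemainder P Σ + mass(Σ) ≤ M`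

abc-iut cell, rung LADDER-ABC:A2.RESCUE.H; R-H ROUND 2 seat abc-iut-rh2-w-1 (Q1′ WEIGHTS typer, kernel side), companion of
`Repair/RHCellWeights.lean` (generic part: weight `t(i, v_ℚ) := ((i+1)² − 1)·(−qLocal_{i+1,v_ℚ})`, knapsack identity, closed-form total).
PROOF-ONLY file (0 definitions, 0 `Prop` facts). At abc-iut-c312-7's sharp print-normalised setting of ANY Dupuy–Hilado pilot datum `X`, for
q-ideles REALISING `P_q` (the context of abc-iut-rh2-q2-eq's p472500 `RH.SigmaStrataEq.offRemainder_le_offPilotGap`, whose `Sum.elim` summand IS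
`t` — `pilotGapSummand_eq`; NOTHING of that bound is re-typed):
* the PER-PLACE SPLIT `t(i, p) = ((i+1)²−1)·(1/[F:ℚ])·Σ_{v | p} P_q(v)·log N(v) = ((i+1)²−1)/(2l·[F:ℚ])·Σ_{v | p, v ∈ S} ord_v(q_v)·log N(v)`
  (`pilotGapWeight_inr_eq_sum_placesOver`, `pilotGapWeight_inr_eq_sum_ordq`; abc-iut-c312-7 `qLocal_settingPrVol_qCentreDH_inr` BY NAME) — read at
  `X := pilotDataOfK D K` the `v`-summand over `l⋇` is MIN-SLICE §(i)'s `c(w,j)·d(w,j)` for the place `w = v` of `K`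
  (`(n_w/[K:ℚ])·(log p_w/e_w)·(j²−1)·m_q(w)/l⋇`); archimedean cells weigh `0` (abc-iut-rp-h1's `CandExplicit30Real.qLocal_settingPrVolSharp_inl`, BY NAME);
* LABEL-INDEPENDENCE of the q-volume DISCHARGED (`qLocal_settingPrVolSharp_labelIndep`), so the generic file's `hindep` is a theorem here;
* the TOTAL **`M = PN(i ↦ Σᶠ_{v_ℚ} t(i,v_ℚ)) = deĝ_lgp(P_Θ) − deĝ(P_q)`** (`totalMass_settingPrVolSharp_eq_pilotGap`: the generic closed form
  `(l⋇−1)(2l⋇+5)/6 = κ − 1`, abc-iut-c312-7 `negLogQ_settingPrVolSharp` «`−|log(q)| = −deĝ(P_q)`», Dupuy–Hilado `ExplicitSzpiro.ndegLgp_thetaPilot`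
  «`deĝ_lgp(P_Θ) = κ·deĝ(P_q)`»), numerically anticipated by abc-iut-rh-kit-2 PASS 18c («M = gap EXACTLY, 781/781»);
* the KNAPSACK INEQUALITY **`offRemainder P Σ + mass(Σ) ≤ deĝ_lgp(P_Θ) − deĝ(P_q)`** for EVERY stratum `Σ ⊆ 𝔽_l^⋇ × V_ℚ`
  (`offRemainder_add_mass_le_pilotGap`, `offRemainder_le_pilotGap_sub_mass`; p472500 + `mass_add_mass_compl`) — MIN-SLICE §(ii)'s
  «`B_triv(Σᶜ) = M − mass(Σ)`; tolerance `Tol` ⟹ condition `mass(Σ) ≥ M − Tol`» (threshold typer rh2-T-1 composes with `Tol` of record);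
* §3 at `X := pilotDataOfK D K`: `deĝ_lgp(P_Θ) − deĝ(P_q) = ((l+1)/24 − 1/(2l))·log(q)` (`pilotGap_pilotDataOfK_eq`; `Cor312Prov.absLogq_eq_ndeg_qPilot_pilotDataOfK`,
  `l = 2l⋇+1`) = the `F_mod`-level gap of `PointDict.gap_pilotData_eq` (`pilotGap_pilotDataOfK_eq_pilotData`) — i.e. `M` IS the `T.gap` of
  abc-iut-rh2-xi-1's tolerance currency (`RH.OffSigma`, p469145; `PointDict.gap_eq`).
HONEST FRAMING: identities/inequalities about OUR typed quantities at ONE family of instantiations; nothing here asserts that abc is proved or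
refuted, or that [IUTchIII] Cor. 3.12 holds or fails at any datum, or takes a side on any author; typed ≠ proved; computed ≠ proved.
[claim: Mochizuki2012, status: disputed] for every IUT locution. [cite: Mochizuki2012, IUTchIII Cor. 3.12 p. 173–174, Prop. 3.9 (i)–(iii) p. 116–117;
IUTchIV Def. 1.9 (i) p. 22, Thm. 1.10 p. 23, Step (viii) p. 30] [cite: DupuyHilado2025, §3.3, §3.9, Thm. 3.10.1] [cite: DupuyHilado2020, §7.12 p. 28]
-/

noncomputable section

open Set Function NumberField IsDedekindDomain
open scoped Pointwise

namespace Summit.ABC.IUTFork.Repair.RH.CellWeights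

open Summit.ABC.IUTFork.Thm311 Summit.ABC.IUTFork.Thm311.Real Summit.ABC.IUTFork.Cor312 Summit.ABC.IUTFork.Cor312.Setting
  Summit.ABC.IUTFork.Cor312Vol Summit.ABC.IUTFork.Cor312Prov Literature.IUT.LogThetaLattice Literature.IUT.LogVolume
  Literature.IUT.HodgeTheaters Literature.IUT.LogVolume.ThetaData
  Summit.ABC.IUTFork.Repair.RH.SigmaLicence Summit.ABC.IUTFork.Repair.RH.SigmaStrataEq

/-! ## §2. At the genuine bed `settingPrVolSharp X`: the per-place split, the total `= deĝ_lgp(P_Θ) − deĝ(P_q)`, the knapsack inequality -/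

section Bed

variable {F : Type} [Field F] [NumberField F] (X : PilotData F) {logv : PadicLogs F} (hlog : LogvAnalytic logv)
  (M : Type) [Field M] [NumberField M]
  (archPk : ∀ (j : (thetaIndex X).Label) (vQ : (thetaIndex X).VQ), Set ((logShellsDH X logv).Packet j vQ))
  (archSub : ∀ (j : (thetaIndex X).Label) (v : (thetaIndex X).V),
    Set ((logShellsDH X logv).Packet j ((thetaIndex X).over v)))
  (Ψ : ℤ → ∀ v : (thetaIndex X).V, v ∈ (thetaIndex X).Vbad → Set ((logShellsDH X logv).StarPacket v))
  (act : ℤ → ∀ v : (thetaIndex X).V, v ∈ (thetaIndex X).Vbad →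
    (logShellsDH X logv).StarPacket v → Module.End ℚ ((logShellsDH X logv).StarPacket v))
  (Mmod : ℤ → ∀ j : (thetaIndex X).LabelStar, Set ((logShellsDH X logv).GlobalPacket j.1))
  (region : ℤ → ∀ j : (thetaIndex X).LabelStar, FinDivisor M → ∀ vQ : (thetaIndex X).VQ,
    Set ((logShellsDH X logv).Packet j.1 vQ))
  (n : ℤ) {HT : Type} {LogLink : HT → HT → Type} {IsFull : ∀ {s t : HT}, LogLink s t → Prop}
  (lat : LGPGaussianLogThetaLattice LogLink IsFull)
  {Frd : Type} {IsoF : Frd → Frd → Type} {Ob : Frd → Type} {realify : Frd → Frd} {Strip : Type}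
  {IsoS : Strip → Strip → Type} {Mv : ∀ v : (thetaIndex X).V, v ∈ (thetaIndex X).Vbad → Type}
  [∀ v h, Monoid (Mv v h)]
  (sig : GlobalLGPFrobenioidSignature (thetaIndex X).lstar (thetaIndex X).V (· ∈ (thetaIndex X).Vbad)
    Frd IsoF Ob realify Strip IsoS Mv)
  (split : SplittingMonoids Mv) {ObΔ : Type} {N : ∀ v : (thetaIndex X).V, v ∈ (thetaIndex X).Vbad → Type}
  [∀ v h, Monoid (N v h)] (qData : QPilotData ObΔ N)
  (tq : ∀ (pp : Nat.Primes) (x : (thetaIndex X).Fibre (.inr pp)), haveI : Fact (pp : ℕ).Prime := ⟨pp.2⟩; kOf X pp.1 x)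
  (t : ∀ (pp : Nat.Primes) (_ : Fin X.lstar) (x : (thetaIndex X).Fibre (.inr pp)),
    haveI : Fact (pp : ℕ).Prime := ⟨pp.2⟩; kOf X pp.1 x)
  (htq0 : ∀ pp x, tq pp x ≠ 0)
  (htq1 : ∀ (pp : Nat.Primes) (x : (thetaIndex X).Fibre (.inr pp)),
    haveI : Fact (pp : ℕ).Prime := ⟨pp.2⟩; placeOf X pp.1 x ∉ X.S → ‖tq pp x‖ = 1)

/-- **abc-iut-rh2-q2-eq's `Sum.elim` summand (p472500 `offRemainder_le_offPilotGap`) IS this file's weight** `t(i, v_ℚ)` at every cell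
(archimedean cells: both are `0`). [folklore] -/
theorem pilotGapSummand_eq (c : Fin (thetaIndex X).lstar × (thetaIndex X).VQ) :
    Sum.elim (fun _ : Unit => (0 : ℝ))
        (fun pp : Nat.Primes => ((((c.1 : ℕ) : ℝ) + 1) ^ 2 - 1) *
          (-(settingPrVolSharp X hlog M archPk archSub Ψ act Mmod region n lat sig split qData tq t htq0 htq1).qLocal
            (labelSucc c.1) (.inr pp))) c.2 =
      ((((c.1 : ℕ) : ℝ) + 1) ^ 2 - 1) *
        (-(settingPrVolSharp X hlog M archPk archSub Ψ act Mmod region n lat sig split qData tq t htq0 htq1).qLocal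
          (labelSucc c.1) c.2) := by
  obtain ⟨i, vQ⟩ := c
  cases vQ with
  | inl u =>
    rw [Sum.elim_inl, CandExplicit30Real.qLocal_settingPrVolSharp_inl X hlog M archPk archSub Ψ act Mmod region n lat sig split qData (t := t) (tq := tq) htq0 htq1
      (labelSucc i) u, neg_zero, mul_zero]
  | inr pp => rfl

/-- **THE PER-PLACE SPLIT of the weight at a prime cell** `(i+1, p)`, for q-ideles REALISING `P_q`:
`t(i, p) = ((i+1)² − 1)·(1/[F:ℚ])·Σ_{v | p} P_q(v)·log N(v)` — abc-iut-c312-7's `qLocal_settingPrVol_qCentreDH_inr` (the packet-normalised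
q-volume at `(j, p)` is `−(1/[F:ℚ])·Σ_{v|p} P_q(v)·log N(v)`, INDEPENDENT of `j`), times the label demand. Read at `X := pilotDataOfK D K`
(`F := K = F(E_F[l])`): the `v`-summand `(j²−1)·P_q(v)·log N(v)/[K:ℚ]`, divided by `l⋇`, is MIN-SLICE §(i)'s `c(w,j)·d(w,j)` for the place
`w = v` of `K` (`P_q(w)·log N(w)/[K:ℚ] = (n_w/[K:ℚ])·(m_q(w)/e_w)·log p_w`). [cite: DupuyHilado2025, §3.9, Thm. 3.10.1]
[cite: Mochizuki2012, IUTchIII Prop. 3.9 (i)–(iii) p. 116–117] [claim: Mochizuki2012, status: disputed] -/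
theorem pilotGapWeight_inr_eq_sum_placesOver
    (htq : ∀ (pp : Nat.Primes) (x : (thetaIndex X).Fibre (.inr pp)),
      haveI : Fact (pp : ℕ).Prime := ⟨pp.2⟩
      Real.log ‖tq pp x‖ = -(X.qPilot (placeOf X pp.1 x)) * logNorm F (placeOf X pp.1 x) / localDegree F (placeOf X pp.1 x))
    (i : Fin (thetaIndex X).lstar) (pp : Nat.Primes) :
    ((((i : ℕ) : ℝ) + 1) ^ 2 - 1) *
        (-(settingPrVolSharp X hlog M archPk archSub Ψ act Mmod region n lat sig split qData tq t htq0 htq1).qLocal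
          (labelSucc i) (.inr pp)) =
      ((((i : ℕ) : ℝ) + 1) ^ 2 - 1) * ((∑ v ∈ placesOver F pp, X.qPilot v * logNorm F v) / Module.finrank ℚ F) := by
  have h : (settingPrVolSharp X hlog M archPk archSub Ψ act Mmod region n lat sig split qData tq t htq0 htq1).qLocal
      (labelSucc i) (.inr pp) = (∑ v ∈ placesOver F pp, -(X.qPilot v) * logNorm F v) / Module.finrank ℚ F :=
    qLocal_settingPrVol_qCentreDH_inr X hlog M archPk archSub Ψ act Mmod region n lat sig split qData
      (fun _ _ => thetaBoxDH X hlog (sharpBoxDH X hlog t)) tq htq0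
      (finite_support_logvol_qRegion_Pr X hlog M archPk archSub Ψ act Mmod region n tq htq0 htq1) htq (labelSucc i) pp
  rw [h]
  simp only [neg_mul, Finset.sum_neg_distrib, neg_div, neg_neg]

open scoped Classical in
/-- **… in Tate orders**: `t(i, p) = ((i+1)² − 1)/(2l·[F:ℚ])·Σ_{v | p, v ∈ S} ord_v(q_v)·log N(v)` (`P_q(v) = ord_v(q_v)/(2l)` on `S`, `0` off
`S`; [IUTchIV] Thm. 1.10 p. 23: `|log(q)| = (1/2l)·log(q)`). Per place `v ∈ S` over `p` and label `j = i+1` the summand is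
`(j²−1)·ord_v(q_v)·log N(v)/(2l·[F:ℚ])` — the «`~j²` label weighting» times the place's share of `log(q)`. [cite: DupuyHilado2025, §3.3]
[cite: Mochizuki2012, IUTchIV Def. 1.9 (i) p. 22, Thm. 1.10 p. 23] [claim: Mochizuki2012, status: disputed] -/
theorem pilotGapWeight_inr_eq_sum_ordq
    (htq : ∀ (pp : Nat.Primes) (x : (thetaIndex X).Fibre (.inr pp)),
      haveI : Fact (pp : ℕ).Prime := ⟨pp.2⟩
      Real.log ‖tq pp x‖ = -(X.qPilot (placeOf X pp.1 x)) * logNorm F (placeOf X pp.1 x) / localDegree F (placeOf X pp.1 x))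
    (i : Fin (thetaIndex X).lstar) (pp : Nat.Primes) :
    ((((i : ℕ) : ℝ) + 1) ^ 2 - 1) *
        (-(settingPrVolSharp X hlog M archPk archSub Ψ act Mmod region n lat sig split qData tq t htq0 htq1).qLocal
          (labelSucc i) (.inr pp)) =
      ((((i : ℕ) : ℝ) + 1) ^ 2 - 1) / (2 * X.l * Module.finrank ℚ F) *
        ∑ v ∈ placesOver F pp with v ∈ X.S, (X.ordq v : ℝ) * logNorm F v := by
  classical
  rw [pilotGapWeight_inr_eq_sum_placesOver X hlog M archPk archSub Ψ act Mmod region n lat sig split qData tq t htq0 htq1 htq i pp]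
  have hsum : ∑ v ∈ placesOver F pp, X.qPilot v * logNorm F v =
      (∑ v ∈ placesOver F pp with v ∈ X.S, (X.ordq v : ℝ) * logNorm F v) / (2 * X.l) := by
    rw [Finset.sum_filter, Finset.sum_div]
    refine Finset.sum_congr rfl fun v _ => ?_
    rw [qPilot_apply_ite]
    split_ifs with hv
    · ring
    · rw [zero_mul, zero_div]
  rw [hsum]
  have hl : (X.l : ℝ) ≠ 0 := by
    have h5 := X.five_le_l
    exact_mod_cast (show X.l ≠ 0 by omega)
  have hd : (Module.finrank ℚ F : ℝ) ≠ 0 := by exact_mod_cast Module.finrank_pos.ne'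
  field_simp

/-- **LABEL-INDEPENDENCE of the q-volume at the bed** (realising q-ideles): `qLocal_{i+1,v_ℚ} = qLocal_{i'+1,v_ℚ}` — the hypothesis
`hindep` of §1 DISCHARGED at `settingPrVolSharp X` (prime packets: the closed form is label-free; archimedean packets: `0`).
[cite: DupuyHilado2025, §3.9, Thm. 3.10.1] [claim: Mochizuki2012, status: disputed] -/
theorem qLocal_settingPrVolSharp_labelIndep
    (htq : ∀ (pp : Nat.Primes) (x : (thetaIndex X).Fibre (.inr pp)),
      haveI : Fact (pp : ℕ).Prime := ⟨pp.2⟩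
      Real.log ‖tq pp x‖ = -(X.qPilot (placeOf X pp.1 x)) * logNorm F (placeOf X pp.1 x) / localDegree F (placeOf X pp.1 x))
    (i i' : Fin (thetaIndex X).lstar) (vQ : (thetaIndex X).VQ) :
    (settingPrVolSharp X hlog M archPk archSub Ψ act Mmod region n lat sig split qData tq t htq0 htq1).qLocal (labelSucc i) vQ =
      (settingPrVolSharp X hlog M archPk archSub Ψ act Mmod region n lat sig split qData tq t htq0 htq1).qLocal (labelSucc i') vQ := by
  cases vQ with
  | inl u =>
    rw [CandExplicit30Real.qLocal_settingPrVolSharp_inl X hlog M archPk archSub Ψ act Mmod region n lat sig split qData (t := t) (tq := tq) htq0 htq1 (labelSucc i) u,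
      CandExplicit30Real.qLocal_settingPrVolSharp_inl X hlog M archPk archSub Ψ act Mmod region n lat sig split qData (t := t) (tq := tq) htq0 htq1 (labelSucc i') u]
  | inr pp =>
    have h : ∀ j : (thetaIndex X).Label,
        (settingPrVolSharp X hlog M archPk archSub Ψ act Mmod region n lat sig split qData tq t htq0 htq1).qLocal j (.inr pp) =
          (∑ v ∈ placesOver F pp, -(X.qPilot v) * logNorm F v) / Module.finrank ℚ F := fun j =>
      qLocal_settingPrVol_qCentreDH_inr X hlog M archPk archSub Ψ act Mmod region n lat sig split qData
        (fun _ _ => thetaBoxDH X hlog (sharpBoxDH X hlog t)) tq htq0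
        (finite_support_logvol_qRegion_Pr X hlog M archPk archSub Ψ act Mmod region n tq htq0 htq1) htq j pp
    rw [h, h]

/-- **THE TOTAL MASS AT THE BED IS THE DUPUY–HILADO PILOT GAP**: for q-ideles realising `P_q`,
`M = PN(i ↦ Σᶠ_{v_ℚ} t(i,v_ℚ)) = deĝ_lgp(P_Θ) − deĝ(P_q)` — the closed form of §1 (`(l⋇−1)(2l⋇+5)/6 = κ − 1`, `κ = (l⋇+1)(2l⋇+1)/6`),
abc-iut-c312-7's `negLogQ_settingPrVolSharp` (`−|log(q)| = −deĝ(P_q)`) and `ExplicitSzpiro.ndegLgp_thetaPilot` (`deĝ_lgp(P_Θ) = κ·deĝ(P_q)`).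
Numerically confirmed on the tabulated bed by abc-iut-rh-kit-2 PASS 18c («M = gap EXACTLY 781/781») before this theorem landed.
[cite: DupuyHilado2025, §3.3, Thm. 3.10.1] [cite: DupuyHilado2020, §7.12 p. 28 l. 18–19] [claim: Mochizuki2012, status: disputed] -/
theorem totalMass_settingPrVolSharp_eq_pilotGap
    (htq : ∀ (pp : Nat.Primes) (x : (thetaIndex X).Fibre (.inr pp)),
      haveI : Fact (pp : ℕ).Prime := ⟨pp.2⟩
      Real.log ‖tq pp x‖ = -(X.qPilot (placeOf X pp.1 x)) * logNorm F (placeOf X pp.1 x) / localDegree F (placeOf X pp.1 x)) :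
    processionNormalized (fun i : Fin (thetaIndex X).lstar => ∑ᶠ vQ : (thetaIndex X).VQ, ((((i : ℕ) : ℝ) + 1) ^ 2 - 1) *
        (-(settingPrVolSharp X hlog M archPk archSub Ψ act Mmod region n lat sig split qData tq t htq0 htq1).qLocal (labelSucc i) vQ)) =
      LgpDivisor.ndegLgp X.thetaPilot - FinDivisor.ndeg F X.qPilot := by
  rw [totalMass_eq_closedForm _
      (qLocal_settingPrVolSharp_labelIndep X hlog M archPk archSub Ψ act Mmod region n lat sig split qData tq t htq0 htq1 htq),
    negLogQ_settingPrVolSharp X hlog M archPk archSub Ψ act Mmod region n lat sig split qData t tq htq0 htq1 htq, neg_neg,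
    ExplicitSzpiro.ndegLgp_thetaPilot X]
  have hl : ((thetaIndex X).lstar : ℕ) = X.lstar := rfl
  rw [hl]
  ring

/-- **THE KNAPSACK INEQUALITY AT THE BED.** For REALISING ideles (Θ- and q-side) and ANY stratum `Σ ⊆ 𝔽_l^⋇ × V_ℚ`:
`offRemainder P Σ + mass(Σ) ≤ deĝ_lgp(P_Θ) − deĝ(P_q)`, `mass(Σ) = PN(i ↦ Σᶠ_{v_ℚ} 1_Σ(i,v_ℚ)·t(i,v_ℚ))` — abc-iut-rh2-q2-eq's
`offRemainder_le_offPilotGap` (p472500: `R_Σ ≤ mass(Σᶜ)`) + the knapsack identity `mass(Σ) + mass(Σᶜ) = M` + `M = deĝ_lgp(P_Θ) − deĝ(P_q)`.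
READING (MIN-SLICE §(ii)): «S on Σ» pays Cor. 3.12 up to `R_Σ ≤ M − mass(Σ)`; with a tolerance `Tol` the condition is `mass(Σ) ≥ M − Tol`
(threshold typer rh2-T-1 composes). [cite: Mochizuki2012, IUTchIII Cor. 3.12 p. 173–174] [cite: DupuyHilado2025, §3.3, Thm. 3.10.1]
[claim: Mochizuki2012, status: disputed] -/
theorem offRemainder_add_mass_le_pilotGap (ht0 : ∀ pp i x, t pp i x ≠ 0)
    (ht1 : ∀ (pp : Nat.Primes) (i : Fin X.lstar) (x : (thetaIndex X).Fibre (.inr pp)),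
      haveI : Fact (pp : ℕ).Prime := ⟨pp.2⟩; placeOf X pp.1 x ∉ X.S → ‖t pp i x‖ = 1)
    (ht : ∀ (pp : Nat.Primes) (i : Fin X.lstar) (x : (thetaIndex X).Fibre (.inr pp)),
      haveI : Fact (pp : ℕ).Prime := ⟨pp.2⟩
      Real.log ‖t pp i x‖ = -(X.thetaPilot i (placeOf X pp.1 x)) * logNorm F (placeOf X pp.1 x) / localDegree F (placeOf X pp.1 x))
    (htq : ∀ (pp : Nat.Primes) (x : (thetaIndex X).Fibre (.inr pp)),
      haveI : Fact (pp : ℕ).Prime := ⟨pp.2⟩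
      Real.log ‖tq pp x‖ = -(X.qPilot (placeOf X pp.1 x)) * logNorm F (placeOf X pp.1 x) / localDegree F (placeOf X pp.1 x))
    (σ : Set (Fin (thetaIndex X).lstar × (thetaIndex X).VQ)) :
    offRemainder (settingPrVolSharp X hlog M archPk archSub Ψ act Mmod region n lat sig split qData tq t htq0 htq1) σ +
        processionNormalized (fun i : Fin (thetaIndex X).lstar => ∑ᶠ vQ : (thetaIndex X).VQ,
          σ.indicator (fun c : Fin (thetaIndex X).lstar × (thetaIndex X).VQ => ((((c.1 : ℕ) : ℝ) + 1) ^ 2 - 1) *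
            (-(settingPrVolSharp X hlog M archPk archSub Ψ act Mmod region n lat sig split qData tq t htq0 htq1).qLocal
              (labelSucc c.1) c.2)) (i, vQ)) ≤
      LgpDivisor.ndegLgp X.thetaPilot - FinDivisor.ndeg F X.qPilot := by
  have hR := offRemainder_le_offPilotGap X hlog M archPk archSub Ψ act Mmod region n lat sig split qData tq t htq0 htq1 ht0 ht1 ht htq σ
  have hfun : (fun c : Fin (thetaIndex X).lstar × (thetaIndex X).VQ =>
      Sum.elim (fun _ : Unit => (0 : ℝ))
        (fun pp : Nat.Primes => ((((c.1 : ℕ) : ℝ) + 1) ^ 2 - 1) *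
          (-(settingPrVolSharp X hlog M archPk archSub Ψ act Mmod region n lat sig split qData tq t htq0 htq1).qLocal
            (labelSucc c.1) (.inr pp))) c.2) =
      fun c : Fin (thetaIndex X).lstar × (thetaIndex X).VQ => ((((c.1 : ℕ) : ℝ) + 1) ^ 2 - 1) *
        (-(settingPrVolSharp X hlog M archPk archSub Ψ act Mmod region n lat sig split qData tq t htq0 htq1).qLocal
          (labelSucc c.1) c.2) :=
    funext (pilotGapSummand_eq X hlog M archPk archSub Ψ act Mmod region n lat sig split qData tq t htq0 htq1)
  rw [hfun] at hR
  rw [← totalMass_settingPrVolSharp_eq_pilotGap X hlog M archPk archSub Ψ act Mmod region n lat sig split qData tq t htq0 htq1 htq,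
    ← mass_add_mass_compl _ σ]
  linarith

/-- **Hence `offRemainder P Σ ≤ (deĝ_lgp(P_Θ) − deĝ(P_q)) − mass(Σ)`**: the off-Σ price in the currency of the gap, for every stratum.
[claim: Mochizuki2012, status: disputed] -/
theorem offRemainder_le_pilotGap_sub_mass (ht0 : ∀ pp i x, t pp i x ≠ 0)
    (ht1 : ∀ (pp : Nat.Primes) (i : Fin X.lstar) (x : (thetaIndex X).Fibre (.inr pp)),
      haveI : Fact (pp : ℕ).Prime := ⟨pp.2⟩; placeOf X pp.1 x ∉ X.S → ‖t pp i x‖ = 1)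
    (ht : ∀ (pp : Nat.Primes) (i : Fin X.lstar) (x : (thetaIndex X).Fibre (.inr pp)),
      haveI : Fact (pp : ℕ).Prime := ⟨pp.2⟩
      Real.log ‖t pp i x‖ = -(X.thetaPilot i (placeOf X pp.1 x)) * logNorm F (placeOf X pp.1 x) / localDegree F (placeOf X pp.1 x))
    (htq : ∀ (pp : Nat.Primes) (x : (thetaIndex X).Fibre (.inr pp)),
      haveI : Fact (pp : ℕ).Prime := ⟨pp.2⟩
      Real.log ‖tq pp x‖ = -(X.qPilot (placeOf X pp.1 x)) * logNorm F (placeOf X pp.1 x) / localDegree F (placeOf X pp.1 x))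
    (σ : Set (Fin (thetaIndex X).lstar × (thetaIndex X).VQ)) :
    offRemainder (settingPrVolSharp X hlog M archPk archSub Ψ act Mmod region n lat sig split qData tq t htq0 htq1) σ ≤
      (LgpDivisor.ndegLgp X.thetaPilot - FinDivisor.ndeg F X.qPilot) -
        processionNormalized (fun i : Fin (thetaIndex X).lstar => ∑ᶠ vQ : (thetaIndex X).VQ,
          σ.indicator (fun c : Fin (thetaIndex X).lstar × (thetaIndex X).VQ => ((((c.1 : ℕ) : ℝ) + 1) ^ 2 - 1) *
            (-(settingPrVolSharp X hlog M archPk archSub Ψ act Mmod region n lat sig split qData tq t htq0 htq1).qLocal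
              (labelSucc c.1) c.2)) (i, vQ)) := by
  have h := offRemainder_add_mass_le_pilotGap X hlog M archPk archSub Ψ act Mmod region n lat sig split qData tq t htq0 htq1 ht0 ht1
    ht htq σ
  linarith

end Bed

/-! ## §3. The gap at the `K`-level pilot datum of an initial Θ-datum: `((l+1)/24 − 1/(2l))·log(q)` = the `F_mod`-level gap -/

section PilotDataOfK

variable {F K Fbar : Type} [Field F] [NumberField F] [Field K] [NumberField K] [Algebra F K] [Field Fbar] [Algebra F Fbar]
  [Algebra K Fbar] {E : WeierstrassCurve F} [E.IsElliptic] {l : ℕ} {Pb : BadPlacePredicates K}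
  (D : InitialThetaData F K Fbar E l Pb)

/-- **At `X := pilotDataOfK D K` the pilot gap is `((l+1)/24 − 1/(2l))·log(q)`** — `deĝ_lgp(P_Θ) = κ·deĝ(P_q)` (`ExplicitSzpiro.ndegLgp_thetaPilot`),
`deĝ_K(P_q^K) = |log(q)| = log(q)/(2l)` (`Cor312Prov.absLogq_eq_ndeg_qPilot_pilotDataOfK`, [IUTchIV] Thm. 1.10 p. 23) and `l = 2l⋇+1`. So the
total mass `M` of §2 at the bed of record `settingPrVolSharp (pilotDataOfK D K) …` is THIS number — abc-iut-rh2-xi-1's `T.gap`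
(`LDHGenuinePoint.gap_eq`: the same closed form with `log(q) = logQAvoid`). [cite: Mochizuki2012, IUTchIV Thm. 1.10 Step (viii) p. 30, p. 23]
[cite: DupuyHilado2025, §3.3] [claim: Mochizuki2012, status: disputed] -/
theorem pilotGap_pilotDataOfK_eq :
    LgpDivisor.ndegLgp (pilotDataOfK D K).thetaPilot - FinDivisor.ndeg K (pilotDataOfK D K).qPilot =
      (((l : ℝ) + 1) / 24 - 1 / (2 * l)) * Cor312Prov.logq D := by
  rw [ExplicitSzpiro.ndegLgp_thetaPilot, ← absLogq_eq_ndeg_qPilot_pilotDataOfK]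
  have hl : (l : ℝ) = 2 * ((pilotDataOfK D K).lstar : ℝ) + 1 := by
    have h := (pilotDataOfK D K).l_eq
    rw [pilotDataOfK_l] at h
    exact_mod_cast h
  have hs : (0 : ℝ) < 2 * ((pilotDataOfK D K).lstar : ℝ) + 1 := by positivity
  unfold Cor312Prov.absLogq
  rw [hl]
  field_simp
  ring

/-- **… and it EQUALS the `F_mod`-level gap** `deĝ_lgp(P_Θ) − deĝ(P_q)` of `ThetaData.pilotData D` (`LDHGenuinePoint.gap_pilotData_eq`: same
closed form) — the quantity `T.gap` of a genuine Θ-volume datum `T` with `T.D = D` is by definition this difference for `T.I.X = pilotData D`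
(`Cor22.ThetaVolumeDatumAt.gap`, `isVolumeInputOf.X_eq`). [IUTchIV] Thm. 1.10 p. 23: «independent of the choice of `F□`».
[cite: Mochizuki2012, IUTchIV Thm. 1.10 p. 23] [claim: Mochizuki2012, status: disputed] -/
theorem pilotGap_pilotDataOfK_eq_pilotData :
    LgpDivisor.ndegLgp (pilotDataOfK D K).thetaPilot - FinDivisor.ndeg K (pilotDataOfK D K).qPilot =
      LgpDivisor.ndegLgp (ThetaData.pilotData D).thetaPilot - FinDivisor.ndeg (fieldOfModuli E) (ThetaData.pilotData D).qPilot := by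
  rw [pilotGap_pilotDataOfK_eq, PointDict.gap_pilotData_eq]

end PilotDataOfK

end Summit.ABC.IUTFork.Repair.RH.CellWeights

end
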